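import Mathlib.RingTheory.Polynomial.Cyclotomic.Roots
import Mathlib.RingTheory.AdjoinRoot
import Mathlib.RingTheory.Localization.Integral
import Mathlib.FieldTheory.Finite.Basic
import Mathlib.NumberTheory.Cyclotomic.PrimitiveRoots
import HarnessLib

/-!
# `−1` is not a sum of two squares in `ℚ(ζ_p)` when the order of `2` modulo `p` is odd

COR-CM (cell `pub-hodgecm2`), binder seat b04 (gen 25), count-neutral claim QUATERNION-CYCLIC-PRIME, part III: the arithmetic
input of parts I–II (`CorCM/GaloisQuaternionCyclicPrimeTwoSheet`, `…Nondegenerate`), PROVED from Mathlib alone.  KERNEL ONLY: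
theorems; no definition, no named fact, no `sorry`.

THEOREM (`aeval_sq_add_sq_ne_neg_one`, `sq_add_sq_ne_neg_one_of_isCyclotomicExtension`).  Let `p` be an odd prime such that
the multiplicative order `f = ord_p(2)` of `2` modulo `p` is ODD (`p = 7, 23, 31, 47, 71, 73, 79, 89, 103, …`).  Then `−1` is
NOT a sum of two squares in `ℚ(ζ_p)`: for every field `L` of characteristic `0`, every primitive `p`-th root of unity
`ζ ∈ L` and all `x, y ∈ ℚ(ζ)`, `x² + y² ≠ −1`.  (This is the «odd» half of the determination of the level of the cyclotomic
fields — `s(ℚ(ζ_p)) = 2` iff `ord_p(2)` is even, else `4` — classically read off the local degree `[ℚ₂(ζ_p):ℚ₂] = ord_p(2)`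
and the Hilbert symbol `(−1,−1)_2`; here an elementary global `2`-adic descent replaces the local theory.)

PROOF.  Work in `Λ = ℤ[X]/(Φ_p)` (a domain) and its reduction `R₂ = 𝔽₂[X]/(Φ_p)`.
(1) In `R₂`, `z^{2^f} = z` for ALL `z` (`Φ_p ∣ X^p − 1 ∣ X^{2^f−1} − 1`, so the `2^f`-power Frobenius is a `𝔽₂`-algebra
endomorphism fixing the generator); hence `R₂` is reduced, and since `f` is odd `3 ∣ 2^{f+1} − 1 = 1 + 2(2^f − 1)`, so
`z ↦ z³` is injective (`z = z^{1 + 2(2^f−1)} = (z³)^d`).  Consequently `a² + ab + b² = 0 ⟹ a³ = b³ ⟹ a = b ⟹ 3a² = a² = 0 ⟹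
a = b = 0` («no primitive cube root of unity in `𝔽_{2^f}`, `f` odd»).
(2) DESCENT: if `u² + v² + n² = 0` in `Λ` with `n ∈ ℕ` then, reading mod `2`, `(u + v + n)² = 0`, so `u + v + n = 2w`;
substituting, `u² + uv + v² = 2(wu + wv − w²) ≡ 0`, so `u, v ∈ 2Λ` by (1), whence `n` is even and `(u/2, v/2, n/2)` is a
smaller solution: `n = 0`.
(3) A relation `x² + y² = −1` in `ℚ(ζ)`, `x = f(ζ)`, `y = g(ζ)`, becomes after clearing denominators `U(ζ)² + V(ζ)² + n² = 0`
with `U, V ∈ ℤ[X]`, `n ≥ 1`, i.e. `u² + v² + n² = 0` in `Λ ↪ L` (`Φ_p` is the minimal polynomial of `ζ` over the integrally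
closed ring `ℤ`) — contradicting (2).

* §1 `two_eq_zero`, `add_sq`, `pow_two_pow_eq_self`, `eq_zero_of_sq_eq_zero`, `eq_zero_of_sq_add_mul_add_sq` — arithmetic of
  `𝔽₂[X]/(Φ_p)`.
* §2 `lift_mk_eq`, `exists_eq_two_mul` — the reduction `Λ → R₂` and its kernel `2Λ`.
* §3 `descent`.
* §4 **`aeval_sq_add_sq_ne_neg_one`**, `sq_add_sq_ne_neg_one_of_mem_adjoin`, **`sq_add_sq_ne_neg_one_of_isCyclotomicExtension`**.

## References

* [FeinGordonSmith1971] B. Fein, B. Gordon, J. H. Smith, *On the representation of −1 as a sum of two squares in an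
  algebraic number field*, J. Number Theory 3 (1971), 310–315 (the level of `ℚ(ζ_m)`; local criterion at `2`).
* [Washington1997] L. C. Washington, *Introduction to Cyclotomic Fields*, Thm. 2.13 (splitting of `2` in `ℚ(ζ_p)`:
  residue degree `ord_p(2)`), Prop. 2.4.

Provenance: Literature home (family `hodge`, namespace `Literature.NumberTheory.NumberFields.CyclotomicSquares`) of the Summits-side `CorCM/CyclotomicFieldSumOfTwoSquares` (cell `pub-hodgecm2`, COR-CM; all its imports are `Literature/` and Mathlib), which `Literature/` may not import; theorems only, no named fact, no definition. Nothing here bears on `HC_CM`. Lane `lit-hodgefound` (Layer A3: CM types, their Kubota ranks and Galois combinatorics), seat p20.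
-/

noncomputable section

open Polynomial

namespace Literature.NumberTheory.NumberFields.CyclotomicSquares

/-! ## §1 Arithmetic of `R₂ = 𝔽₂[X]/(Φ_p)` -/

section R2

variable {p k : ℕ}

/-- `2 = 0` in `𝔽₂[X]/(Φ_p)`. [cite: FeinGordonSmith1971, pp. 310–315] -/
theorem two_eq_zero : (2 : AdjoinRoot (cyclotomic p (ZMod 2))) = 0 := by
  rw [← map_ofNat (algebraMap (ZMod 2) (AdjoinRoot (cyclotomic p (ZMod 2)))) 2,
    show (2 : ZMod 2) = 0 from rfl, map_zero]

/-- `(a + b)² = a² + b²` in characteristic `2`. [cite: FeinGordonSmith1971, pp. 310–315] -/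
theorem add_sq (a b : AdjoinRoot (cyclotomic p (ZMod 2))) : (a + b) ^ 2 = a ^ 2 + b ^ 2 := by
  linear_combination (a * b) * two_eq_zero (p := p)

/-- `(a + b)^{2^k} = a^{2^k} + b^{2^k}`. [cite: FeinGordonSmith1971, pp. 310–315] -/
theorem add_pow_two_pow (a b : AdjoinRoot (cyclotomic p (ZMod 2))) (k : ℕ) :
    (a + b) ^ 2 ^ k = a ^ 2 ^ k + b ^ 2 ^ k := by
  induction k with
  | zero => simp
  | succ k ih => rw [pow_succ, pow_mul, ih, add_sq, ← pow_mul, ← pow_mul]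

/-- The class of `X` is a `p`-th root of unity: `Φ_p ∣ X^p − 1`. [cite: FeinGordonSmith1971, pp. 310–315] -/
theorem root_pow_eq_one : AdjoinRoot.root (cyclotomic p (ZMod 2)) ^ p = 1 := by
  have h : AdjoinRoot.mk (cyclotomic p (ZMod 2)) (X ^ p - 1) = 0 :=
    AdjoinRoot.mk_eq_zero.2 (cyclotomic.dvd_X_pow_sub_one p (ZMod 2))
  rw [map_sub, map_pow, AdjoinRoot.mk_X, map_one, sub_eq_zero] at h
  exact h

/-- If `p ∣ 2^k − 1` then `X^{2^k} = X` in `𝔽₂[X]/(Φ_p)`. [cite: FeinGordonSmith1971, pp. 310–315] -/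
theorem root_pow_two_pow (hpk : p ∣ 2 ^ k - 1) :
    AdjoinRoot.root (cyclotomic p (ZMod 2)) ^ 2 ^ k = AdjoinRoot.root (cyclotomic p (ZMod 2)) := by
  obtain ⟨m, hm⟩ := hpk
  have h2k : 2 ^ k = p * m + 1 := by have := Nat.one_le_two_pow (n := k); omega
  rw [h2k, pow_succ, pow_mul, root_pow_eq_one, one_pow, one_mul]

/-- **`z^{2^k} = z` for every `z ∈ 𝔽₂[X]/(Φ_p)` when `p ∣ 2^k − 1`**: the `2^k`-power Frobenius is an `𝔽₂`-algebra
endomorphism of `𝔽₂[X]/(Φ_p)` fixing the generator. [cite: Washington1997, Thm. 2.13] -/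
theorem pow_two_pow_eq_self (hpk : p ∣ 2 ^ k - 1) (z : AdjoinRoot (cyclotomic p (ZMod 2))) : z ^ 2 ^ k = z := by
  let F : AdjoinRoot (cyclotomic p (ZMod 2)) →ₐ[ZMod 2] AdjoinRoot (cyclotomic p (ZMod 2)) :=
    { toFun := fun z => z ^ 2 ^ k
      map_one' := one_pow _
      map_mul' := fun a b => mul_pow a b _
      map_zero' := zero_pow (pow_ne_zero k two_ne_zero)
      map_add' := fun a b => add_pow_two_pow a b k
      commutes' := fun c => by rw [← map_pow, ZMod.pow_card_pow] }
  have hF : F = AlgHom.id (ZMod 2) _ := AdjoinRoot.algHom_ext (by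
    simp only [F, AlgHom.coe_mk, RingHom.coe_mk, MonoidHom.coe_mk, OneHom.coe_mk, AlgHom.coe_id, id_eq]
    exact root_pow_two_pow hpk)
  have hz := DFunLike.congr_fun hF z
  simpa [F] using hz

/-- `𝔽₂[X]/(Φ_p)` is reduced (`p ∣ 2^k − 1`, `k ≥ 1`). [cite: FeinGordonSmith1971, pp. 310–315] -/
theorem eq_zero_of_sq_eq_zero (hpk : p ∣ 2 ^ k - 1) (hk : 0 < k) (a : AdjoinRoot (cyclotomic p (ZMod 2)))
    (h : a ^ 2 = 0) : a = 0 := by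
  obtain ⟨k', rfl⟩ := Nat.exists_eq_succ_of_ne_zero hk.ne'
  rw [← pow_two_pow_eq_self hpk a, pow_succ', pow_mul, h]
  exact zero_pow (pow_ne_zero k' two_ne_zero)

/-- `z^{1 + m(2^k − 1)} = z`. [cite: FeinGordonSmith1971, pp. 310–315] -/
theorem pow_one_add_mul (hpk : p ∣ 2 ^ k - 1) (z : AdjoinRoot (cyclotomic p (ZMod 2))) (m : ℕ) :
    z ^ (1 + m * (2 ^ k - 1)) = z := by
  induction m with
  | zero => simp
  | succ m ih =>
    have h1 : 1 + (m + 1) * (2 ^ k - 1) = (1 + m * (2 ^ k - 1)) + (2 ^ k - 1) := by ring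
    rw [h1, pow_add, ih, ← pow_succ', Nat.sub_add_cancel Nat.one_le_two_pow, pow_two_pow_eq_self hpk]

/-- **No primitive cube root of unity in `𝔽₂[X]/(Φ_p)` when `ord_p(2)` is odd**: `a² + ab + b² = 0` forces `a = b = 0`
(`a³ = b³`, and cubing is injective because `3 ∣ 2^{k+1} − 1 = 1 + 2(2^k − 1)` for `k` odd). [cite: FeinGordonSmith1971, pp. 310–315] -/
theorem eq_zero_of_sq_add_mul_add_sq (hpk : p ∣ 2 ^ k - 1) (hk : Odd k) (a b : AdjoinRoot (cyclotomic p (ZMod 2)))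
    (h : a ^ 2 + a * b + b ^ 2 = 0) : a = 0 ∧ b = 0 := by
  have h2 := two_eq_zero (p := p)
  have h3 : a ^ 3 = b ^ 3 := by linear_combination (a + b) * h - (a ^ 2 * b + a * b ^ 2 + b ^ 3) * h2
  -- `3 ∣ 1 + 2(2^k - 1)`
  obtain ⟨d, hd⟩ : ∃ d, 1 + 2 * (2 ^ k - 1) = 3 * d := by
    obtain ⟨j, rfl⟩ := hk
    have hmod := Nat.ModEq.pow (j + 1) (show 4 ≡ 1 [MOD 3] by decide)
    rw [one_pow] at hmod
    have h4 : 3 ∣ 4 ^ (j + 1) - 1 := (Nat.modEq_iff_dvd' (Nat.one_le_pow _ _ (by norm_num))).1 hmod.symm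
    obtain ⟨d, hd⟩ := h4
    refine ⟨d, ?_⟩
    have h2j : 2 ^ (2 * j + 1) = 2 * 4 ^ j := by
      rw [pow_succ, pow_mul]; ring
    have h1 : 1 ≤ 4 ^ j := Nat.one_le_pow _ _ (by norm_num)
    rw [pow_succ] at hd
    rw [h2j]; omega
  have hab : a = b := by
    rw [← pow_one_add_mul hpk a 2, hd, pow_mul, h3, ← pow_mul, ← hd, pow_one_add_mul hpk b 2]
  subst hab
  have ha2 : a ^ 2 = 0 := by linear_combination h - a ^ 2 * h2
  have ha := eq_zero_of_sq_eq_zero hpk hk.pos a ha2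
  exact ⟨ha, ha⟩

end R2

/-! ## §2 The reduction `ℤ[X]/(Φ_p) → 𝔽₂[X]/(Φ_p)` and its kernel -/

section Reduction

variable {p : ℕ}

/-- `Φ_p(X) = 0` in `𝔽₂[X]/(Φ_p)`, read through `ℤ → 𝔽₂[X]/(Φ_p)`. [cite: FeinGordonSmith1971, pp. 310–315] -/
theorem eval₂_cyclotomic_int_root :
    (cyclotomic p ℤ).eval₂ (Int.castRingHom (AdjoinRoot (cyclotomic p (ZMod 2))))
      (AdjoinRoot.root (cyclotomic p (ZMod 2))) = 0 := by
  have h : aeval (AdjoinRoot.root (cyclotomic p (ZMod 2))) (cyclotomic p (ZMod 2)) = 0 := by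
    rw [AdjoinRoot.aeval_eq, AdjoinRoot.mk_self]
  rw [aeval_def, eval₂_eq_eval_map, map_cyclotomic] at h
  rwa [eval₂_eq_eval_map, map_cyclotomic_int]

/-- The reduction map on classes of integer polynomials: `π(U mod Φ_p) = (U mod 2) mod Φ_p`. [cite: FeinGordonSmith1971, pp. 310–315] -/
theorem lift_mk_eq (U : ℤ[X]) :
    AdjoinRoot.lift (Int.castRingHom _) (AdjoinRoot.root (cyclotomic p (ZMod 2))) eval₂_cyclotomic_int_root
        (AdjoinRoot.mk (cyclotomic p ℤ) U) =
      AdjoinRoot.mk (cyclotomic p (ZMod 2)) (U.map (Int.castRingHom (ZMod 2))) := by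
  rw [AdjoinRoot.lift_mk, ← AdjoinRoot.aeval_eq, aeval_def, eval₂_map]
  congr 1

/-- **The kernel of the reduction is `2Λ`**: if `U mod 2` is divisible by `Φ_p` in `𝔽₂[X]` then `U ≡ 2W (mod Φ_p)` in
`ℤ[X]`. [cite: FeinGordonSmith1971, pp. 310–315] -/
theorem exists_eq_two_mul (U : ℤ[X]) (hU : AdjoinRoot.mk (cyclotomic p (ZMod 2)) (U.map (Int.castRingHom (ZMod 2))) = 0) :
    ∃ W : ℤ[X], AdjoinRoot.mk (cyclotomic p ℤ) U = 2 * AdjoinRoot.mk (cyclotomic p ℤ) W := by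
  rw [AdjoinRoot.mk_eq_zero] at hU
  obtain ⟨V₂, hV₂⟩ := hU
  obtain ⟨V, rfl⟩ := map_surjective (Int.castRingHom (ZMod 2)) (ZMod.ringHom_surjective _) V₂
  have hdiff : (U - cyclotomic p ℤ * V).map (Int.castRingHom (ZMod 2)) = 0 := by
    rw [Polynomial.map_sub, Polynomial.map_mul, map_cyclotomic_int, hV₂, sub_self]
  have hdvd : C (2 : ℤ) ∣ U - cyclotomic p ℤ * V := by
    rw [C_dvd_iff_dvd_coeff]
    intro i
    have hi := congrArg (fun q : (ZMod 2)[X] => q.coeff i) hdiff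
    simp only [coeff_map, coeff_zero, eq_intCast] at hi
    exact_mod_cast (ZMod.intCast_zmod_eq_zero_iff_dvd _ 2).1 hi
  obtain ⟨W, hW⟩ := hdvd
  refine ⟨W, ?_⟩
  have hU' : U = cyclotomic p ℤ * V + C 2 * W := by rw [← hW]; ring
  rw [hU', map_add, map_mul, AdjoinRoot.mk_self, zero_mul, zero_add, map_mul, AdjoinRoot.mk_C, map_ofNat]

end Reduction

/-! ## §3 The descent in `Λ = ℤ[X]/(Φ_p)` -/

section Descent

variable {p k : ℕ}

/-- `Λ = ℤ[X]/(Φ_p)` is a domain (`Φ_p` is irreducible over `ℤ`). [cite: FeinGordonSmith1971, pp. 310–315] -/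
theorem isDomain (hp : 0 < p) : IsDomain (AdjoinRoot (cyclotomic p ℤ)) :=
  AdjoinRoot.isDomain_of_prime (cyclotomic.irreducible hp).prime

/-- `2 ≠ 0` in `Λ`. [cite: FeinGordonSmith1971, pp. 310–315] -/
theorem two_ne_zero' (hp : 0 < p) : (2 : AdjoinRoot (cyclotomic p ℤ)) ≠ 0 := by
  have hdeg : (cyclotomic p ℤ).degree ≠ 0 := by
    rw [degree_cyclotomic]
    exact_mod_cast (Nat.totient_pos.2 hp).ne'
  have h := (AdjoinRoot.of.injective_of_degree_ne_zero hdeg).ne (show (2 : ℤ) ≠ 0 by norm_num)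
  rwa [map_ofNat, map_zero] at h

/-- `𝔽₂[X]/(Φ_p)` is non-trivial. [cite: FeinGordonSmith1971, pp. 310–315] -/
theorem nontrivial (hp : 0 < p) : Nontrivial (AdjoinRoot (cyclotomic p (ZMod 2))) := by
  refine AdjoinRoot.nontrivial _ ?_
  rw [degree_cyclotomic]
  exact_mod_cast (Nat.totient_pos.2 hp).ne'

/-- **THE DESCENT.**  If `ord_p(2)` (more generally some `k` with `p ∣ 2^k − 1`) is odd, the only solution of
`u² + v² + n² = 0` in `Λ = ℤ[X]/(Φ_p)` with `n ∈ ℕ` has `n = 0`. [cite: FeinGordonSmith1971, pp. 310–315] -/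
theorem descent (hp : 0 < p) (hpk : p ∣ 2 ^ k - 1) (hk : Odd k) :
    ∀ (n : ℕ) (u v : AdjoinRoot (cyclotomic p ℤ)), u ^ 2 + v ^ 2 + (n : AdjoinRoot (cyclotomic p ℤ)) ^ 2 = 0 → n = 0 := by
  haveI := isDomain hp
  haveI := nontrivial hp
  have h2Λ := two_ne_zero' hp
  set π : AdjoinRoot (cyclotomic p ℤ) →+* AdjoinRoot (cyclotomic p (ZMod 2)) :=
    AdjoinRoot.lift (Int.castRingHom _) (AdjoinRoot.root (cyclotomic p (ZMod 2))) eval₂_cyclotomic_int_root with hπ_def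
  have hπ2 : π 2 = 0 := by rw [map_ofNat, two_eq_zero]
  have hker : ∀ u : AdjoinRoot (cyclotomic p ℤ), π u = 0 → ∃ u', u = 2 * u' := fun u hu => by
    induction u using AdjoinRoot.induction_on with
    | ih U =>
      rw [hπ_def, lift_mk_eq] at hu
      obtain ⟨W, hW⟩ := exists_eq_two_mul U hu
      exact ⟨_, hW⟩
  intro n
  induction n using Nat.strong_induction_on with
  | _ n ih =>
  intro u v h
  rcases Nat.eq_zero_or_pos n with rfl | hn
  · rfl
  -- mod 2: `(u + v + n)² = 0`, so `u + v + n = 2w`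
  have h1 : (π u + π v + π n) ^ 2 = 0 := by
    have := congrArg π h
    rw [map_add, map_add, map_pow, map_pow, map_pow, map_zero] at this
    rwa [add_sq, add_sq]
  have h1' : π (u + v + n) = 0 := by
    rw [map_add, map_add]
    exact eq_zero_of_sq_eq_zero hpk hk.pos _ h1
  obtain ⟨w, hw⟩ := hker _ h1'
  -- substitute `n = 2w - u - v`: `u² + uv + v² = 2(wu + wv - w²)`
  have hn' : (n : AdjoinRoot (cyclotomic p ℤ)) = 2 * w - u - v := by linear_combination hw
  have h3 : u ^ 2 + u * v + v ^ 2 = 2 * (w * u + w * v - w ^ 2) := by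
    have h3' : (2 : AdjoinRoot (cyclotomic p ℤ)) * (u ^ 2 + u * v + v ^ 2 - 2 * (w * u + w * v - w ^ 2)) = 0 := by
      rw [hn'] at h
      linear_combination h
    linear_combination (mul_eq_zero.1 h3').resolve_left h2Λ
  have h4 : (π u) ^ 2 + π u * π v + (π v) ^ 2 = 0 := by
    have := congrArg π h3
    rwa [map_mul, hπ2, zero_mul, map_add, map_add, map_pow, map_mul, map_pow] at this
  obtain ⟨hu0, hv0⟩ := eq_zero_of_sq_add_mul_add_sq hpk hk _ _ h4
  obtain ⟨u', rfl⟩ := hker u hu0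
  obtain ⟨v', rfl⟩ := hker v hv0
  -- `n` is even
  have hπn : π (n : AdjoinRoot (cyclotomic p ℤ)) = 0 := by
    rw [hn', map_sub, map_sub, map_mul, map_mul, map_mul, hπ2, zero_mul, zero_mul, zero_mul, sub_zero, sub_zero]
  have hn2 : 2 ∣ n := by
    rw [map_natCast, ← map_natCast (algebraMap (ZMod 2) (AdjoinRoot (cyclotomic p (ZMod 2)))), map_eq_zero] at hπn
    exact (ZMod.natCast_eq_zero_iff n 2).1 hπn
  obtain ⟨n', rfl⟩ := hn2
  -- divide by `4`
  have h5 : u' ^ 2 + v' ^ 2 + (n' : AdjoinRoot (cyclotomic p ℤ)) ^ 2 = 0 := by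
    have h5' : (2 : AdjoinRoot (cyclotomic p ℤ)) ^ 2 * (u' ^ 2 + v' ^ 2 + (n' : AdjoinRoot (cyclotomic p ℤ)) ^ 2) = 0 := by
      rw [← h]; push_cast; ring
    exact (mul_eq_zero.1 h5').resolve_left (pow_ne_zero 2 h2Λ)
  have hn'0 := ih n' (by omega) u' v' h5
  omega

end Descent

/-! ## §4 Fields containing a primitive `p`-th root of unity -/

section Field

variable {p : ℕ} {L : Type*} [Field L] [CharZero L] {ζ : L}

/-- **THEOREM.  If `p` is a prime with `ord_p(2)` odd and `ζ` is a primitive `p`-th root of unity in a field of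
characteristic zero, then `f(ζ)² + g(ζ)² ≠ −1` for all `f, g ∈ ℚ[X]`: `−1` is not a sum of two squares in `ℚ(ζ_p)`.**
[cite: FeinGordonSmith1971, pp. 310–315] -/
theorem aeval_sq_add_sq_ne_neg_one (hp : p.Prime) (hodd : Odd (orderOf (2 : ZMod p))) (hζ : IsPrimitiveRoot ζ p)
    (f g : ℚ[X]) : aeval ζ f ^ 2 + aeval ζ g ^ 2 ≠ -1 := by
  intro h
  haveI : NeZero p := ⟨hp.ne_zero⟩
  haveI : Fact p.Prime := ⟨hp⟩
  -- `p ∣ 2^k - 1`, `k = ord_p(2)` odd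
  have hpk : p ∣ 2 ^ orderOf (2 : ZMod p) - 1 := by
    rw [← ZMod.natCast_eq_zero_iff, Nat.cast_sub Nat.one_le_two_pow, Nat.cast_pow, Nat.cast_ofNat,
      pow_orderOf_eq_one, Nat.cast_one, sub_self]
  -- clear denominators
  obtain ⟨b₁, hb₁, hF⟩ := IsLocalization.integerNormalization_spec (nonZeroDivisors ℤ) f
  obtain ⟨b₂, hb₂, hG⟩ := IsLocalization.integerNormalization_spec (nonZeroDivisors ℤ) g
  set F := IsLocalization.integerNormalization (nonZeroDivisors ℤ) f
  set G := IsLocalization.integerNormalization (nonZeroDivisors ℤ) g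
  have hb0 : b₁ * b₂ ≠ 0 := mul_ne_zero (nonZeroDivisors.ne_zero hb₁) (nonZeroDivisors.ne_zero hb₂)
  have hF' : aeval ζ F = (b₁ : L) * aeval ζ f := by
    rw [← aeval_map_algebraMap ℚ ζ F, hF, map_zsmul, zsmul_eq_mul]
  have hG' : aeval ζ G = (b₂ : L) * aeval ζ g := by
    rw [← aeval_map_algebraMap ℚ ζ G, hG, map_zsmul, zsmul_eq_mul]
  -- `Λ = ℤ[X]/(Φ_p) ↪ L` along `X ↦ ζ`
  have hinj : ∀ P : ℤ[X], aeval ζ P = 0 → AdjoinRoot.mk (cyclotomic p ℤ) P = 0 := fun P hP => by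
    rw [AdjoinRoot.mk_eq_zero, cyclotomic_eq_minpoly hζ hp.pos]
    exact minpoly.isIntegrallyClosed_dvd (hζ.isIntegral hp.pos) hP
  -- the relation `U² + V² + n² = 0` in `Λ`
  set n : ℕ := (b₁ * b₂).natAbs with hn_def
  have hrel : AdjoinRoot.mk (cyclotomic p ℤ) ((C b₂ * F) ^ 2 + (C b₁ * G) ^ 2 + C ((n : ℤ) ^ 2)) = 0 := by
    apply hinj
    have hn2 : (n : L) ^ 2 = ((b₁ : L) * (b₂ : L)) ^ 2 := by
      have e := congrArg (Int.cast : ℤ → L) (Int.natAbs_pow_two (b₁ * b₂))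
      rwa [Int.cast_pow, Int.cast_pow, Int.cast_natCast, Int.cast_mul] at e
    simp only [map_add, map_pow, map_mul, eq_intCast, map_intCast, hF', hG']
    push_cast
    rw [hn2]
    linear_combination ((b₁ : L) * (b₂ : L)) ^ 2 * h
  have h0 := descent hp.pos hpk hodd n (AdjoinRoot.mk _ (C b₂ * F)) (AdjoinRoot.mk _ (C b₁ * G))
    (by simpa using hrel)
  exact hb0 (Int.natAbs_eq_zero.1 h0)

/-- The same for elements of the subalgebra `ℚ[ζ] = ℚ(ζ)` of `L`. [cite: FeinGordonSmith1971, pp. 310–315] -/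
theorem sq_add_sq_ne_neg_one_of_mem_adjoin (hp : p.Prime) (hodd : Odd (orderOf (2 : ZMod p)))
    (hζ : IsPrimitiveRoot ζ p) {x y : L} (hx : x ∈ Algebra.adjoin ℚ {ζ}) (hy : y ∈ Algebra.adjoin ℚ {ζ}) :
    x ^ 2 + y ^ 2 ≠ -1 := by
  rw [Algebra.adjoin_singleton_eq_range_aeval] at hx hy
  obtain ⟨f, rfl⟩ := hx
  obtain ⟨g, rfl⟩ := hy
  exact aeval_sq_add_sq_ne_neg_one hp hodd hζ f g

/-- **`−1` is not a sum of two squares in the `p`-th cyclotomic field** (`ord_p(2)` odd), for any model `L/ℚ` of it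
(Mathlib convention: `[Field L] [CharZero L] [IsCyclotomicExtension {p} ℚ L]`). [cite: FeinGordonSmith1971, pp. 310–315] -/
theorem sq_add_sq_ne_neg_one_of_isCyclotomicExtension (hp : p.Prime) (hodd : Odd (orderOf (2 : ZMod p)))
    [IsCyclotomicExtension {p} ℚ L] (x y : L) : x ^ 2 + y ^ 2 ≠ -1 := by
  haveI : NeZero p := ⟨hp.ne_zero⟩
  have hζ := IsCyclotomicExtension.zeta_spec p ℚ L
  have htop := IsCyclotomicExtension.adjoin_primitive_root_eq_top (A := ℚ) hζ
  have hx : x ∈ Algebra.adjoin ℚ {IsCyclotomicExtension.zeta p ℚ L} := by rw [htop]; exact Algebra.mem_top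
  have hy : y ∈ Algebra.adjoin ℚ {IsCyclotomicExtension.zeta p ℚ L} := by rw [htop]; exact Algebra.mem_top
  exact sq_add_sq_ne_neg_one_of_mem_adjoin hp hodd hζ hx hy

end Field

end Literature.NumberTheory.NumberFields.CyclotomicSquares

end
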